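import Mathlib.Analysis.Normed.Ring.Units
import Mathlib.Analysis.Normed.Operator.NormedSpace
import Mathlib.Analysis.Complex.Basic
import Mathlib.Analysis.RCLike.Basic
import HarnessLib

/-!
# A bounded inverse is at least as large as the reciprocal distance from `0` to the spectrum

Analysis/OperatorTheory file (everything proved, no named facts). Let `E` be a Banach space over a
nontrivially normed field `𝕜`, `p ⊆ E` a subspace (the DOMAIN) and `L : p →ₗ[𝕜] E` a linear map (an
unbounded operator, no closedness needed) with a BOUNDED two-sided inverse `B : E →L[𝕜] E`
(`HasBoundedInverse p L B`: `B` maps into `p`, `L (B f) = f`, `B (L u) = u`). Then for every scalar `μ`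
with `‖μ‖ ‖B‖ < 1` the shifted operator `L − μ` is bijective `p → E`
(`bijective_resolventShift_of_norm_mul_lt`); equivalently, if `μ` is a spectral point of `L` in the
weakest sense — `L − μ : p → E` is not bijective (`MemSpectrum`) — then `1 ≤ ‖μ‖ ‖B‖`
(`one_le_norm_mul_norm_of_memSpectrum`), i.e. `‖L⁻¹‖ ≥ 1 / dist(0, σ(L))`.

Proof: `L − μ = (1 − μ B) ∘ L` on `p` (because `B (L u) = u`), `L : p → E` is bijective with inverse
`B`, and `1 − μ B` is a unit of the Banach algebra `E →L[𝕜] E` by the Neumann series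
(`Units.oneSub`, `‖μ B‖ < 1`).

The concrete corollary `four_le_norm_of_quarter_memSpectrum` (over `ℂ`): if `1/4` is a spectral point of
`L` then `‖B‖ ≥ 4`.

## Why it is here (source and use)

Standard functional analysis ([folklore]; the Neumann-series argument is e.g. Kato, *Perturbation Theory
for Linear Operators*, IV §3.1). It is the abstract step behind the remark of the cell note
`pub-nsjs/pub-nsjs-typer/LEMMA-D.md` §7 (Jia–Šverák programme, certified-enclosure lane): the `L² → L²`
inverse bound `K₀ = ‖𝓛_U⁻¹‖_{L²_σ → L²_σ}` of the linearisation `𝓛_U` of the profile equation in similarity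
variables (tree sign, `Literature.Analysis.FluidPDE.GuillodSverak2023.ProfileCAP`) is at least `4` as
soon as `1/4` is a spectral point of `𝓛_U` on `L²_σ`. That spectral input is NOT a statement of
Jia–Šverák 2015 (their Lemma 2.1 gives only the INCLUSION `ρ(𝓛) ⊇ {Re λ > −1/4}` in their sign, i.e.
`σ(𝓛) ⊆ {Re λ ≤ −1/4}`); it follows from Metafune's computation of the `L^p`-spectrum of the
Ornstein–Uhlenbeck operator `Δ + ⟨Bx, ∇⟩` (Ann. Sc. Norm. Super. Pisa (4) 30 (2001) 97–124, Thm. 4.4: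
for `2 ≤ p < ∞` and `σ(B) ⊂ ℂ₊` the spectrum is the closed half-plane `{Re μ ≤ −tr(B)/p}` and every point
of the open half-plane is an eigenvalue; here `B = ½ I₃`, `p = 2`, `tr(B)/p = 3/4`) transported to
divergence-free fields and to the perturbed operator (explicit divergence-free eigenfunctions and Weyl's
theorem on relatively compact perturbations) in the paper-level cell note `LEMMA-K0.md`; nothing of that
analysis is claimed here.

## References

* T. Kato, *Perturbation Theory for Linear Operators*, 2nd ed., Springer 1976, IV §3.1 (Neumann series),
  IV Thm. 5.26 (stability of the essential spectrum). [Kato1976]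
* G. Metafune, *L^p-spectrum of Ornstein–Uhlenbeck operators*, Ann. Sc. Norm. Super. Pisa Cl. Sci. (4) 30
  (2001) 97–124, Thm. 4.4. [Metafune2001]
* H. Jia, V. Šverák, J. Funct. Anal. 268 (2015) 3734–3766, Lemma 2.1 (resolvent set of `𝓛`).
  [JiaSverak2015]
-/

namespace Literature.Analysis.OperatorTheory

variable {𝕜 E : Type*} [NontriviallyNormedField 𝕜] [NormedAddCommGroup E] [NormedSpace 𝕜 E]

/-- `B` is a bounded two-sided inverse of the (unbounded) operator `L : p →ₗ[𝕜] E` with domain `p`: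
`B` maps into `p`, `L ∘ B = id` on `E`, `B ∘ L = id` on `p`. [folklore] -/
structure HasBoundedInverse (p : Submodule 𝕜 E) (L : p →ₗ[𝕜] E) (B : E →L[𝕜] E) : Prop where
  mem : ∀ f : E, B f ∈ p
  right_inv : ∀ f : E, L ⟨B f, mem f⟩ = f
  left_inv : ∀ u : p, B (L u) = (u : E)

/-- The shifted operator `L − μ : p → E`. [folklore] -/
def resolventShift (p : Submodule 𝕜 E) (L : p →ₗ[𝕜] E) (μ : 𝕜) : p →ₗ[𝕜] E :=
  L - μ • p.subtype

/-- Pointwise form of the shift: `(L − μ) u = L u − μ u`. [folklore] -/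
@[simp] theorem resolventShift_apply (p : Submodule 𝕜 E) (L : p →ₗ[𝕜] E) (μ : 𝕜) (u : p) :
    resolventShift p L μ u = L u - μ • (u : E) := by
  simp [resolventShift]

/-- `μ` is a spectral point of `L` in the weakest sense: `L − μ : p → E` is not bijective. (Every
notion of spectrum for a closed operator on a Banach space contains this set; for a closed `L` with the
domain carrying the graph norm it is the spectrum.) [folklore] -/
def MemSpectrum (p : Submodule 𝕜 E) (L : p →ₗ[𝕜] E) (μ : 𝕜) : Prop :=
  ¬ Function.Bijective (resolventShift p L μ)

/-- The factorisation `L − μ = (1 − μ B) ∘ L` on the domain. [folklore] -/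
theorem resolventShift_eq_oneSub_comp {p : Submodule 𝕜 E} {L : p →ₗ[𝕜] E} {B : E →L[𝕜] E}
    (h : HasBoundedInverse p L B) (μ : 𝕜) (u : p) :
    resolventShift p L μ u = ((1 : E →L[𝕜] E) - μ • B) (L u) := by
  simp [h.left_inv u]

variable [CompleteSpace E]

/-- **Neumann-series resolvent**: if `‖μ‖ ‖B‖ < 1` then `L − μ : p → E` is bijective. [folklore] -/
theorem bijective_resolventShift_of_norm_mul_lt {p : Submodule 𝕜 E} {L : p →ₗ[𝕜] E}
    {B : E →L[𝕜] E} (h : HasBoundedInverse p L B) {μ : 𝕜} (hμ : ‖μ‖ * ‖B‖ < 1) :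
    Function.Bijective (resolventShift p L μ) := by
  have hT : ‖μ • B‖ < 1 := by
    calc ‖μ • B‖ = ‖μ‖ * ‖B‖ := norm_smul μ B
      _ < 1 := hμ
  set W : (E →L[𝕜] E)ˣ := Units.oneSub (μ • B) hT with hW
  have hWval : (W : E →L[𝕜] E) = (1 : E →L[𝕜] E) - μ • B := rfl
  constructor
  · intro u v huv
    rw [resolventShift_eq_oneSub_comp h, resolventShift_eq_oneSub_comp h, ← hWval] at huv
    have h1 : L u = L v := by
      have := congrArg (fun x => (↑W⁻¹ : E →L[𝕜] E) x) huv
      simpa [← ContinuousLinearMap.comp_apply, ← ContinuousLinearMap.mul_def] using this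
    have := congrArg B h1
    rw [h.left_inv, h.left_inv] at this
    exact Subtype.ext this
  · intro f
    refine ⟨⟨B ((↑W⁻¹ : E →L[𝕜] E) f), h.mem _⟩, ?_⟩
    rw [resolventShift_eq_oneSub_comp h, h.right_inv, ← hWval]
    simp [← ContinuousLinearMap.comp_apply, ← ContinuousLinearMap.mul_def]

/-- **The inverse bound from the spectrum**: a spectral point `μ` of `L` forces `1 ≤ ‖μ‖ ‖B‖` for every
bounded two-sided inverse `B` of `L`, i.e. `‖L⁻¹‖ ≥ 1 / |μ|`. [folklore] -/
theorem one_le_norm_mul_norm_of_memSpectrum {p : Submodule 𝕜 E} {L : p →ₗ[𝕜] E} {B : E →L[𝕜] E}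
    (h : HasBoundedInverse p L B) {μ : 𝕜} (hμ : MemSpectrum p L μ) : 1 ≤ ‖μ‖ * ‖B‖ := by
  by_contra hlt
  exact hμ (bijective_resolventShift_of_norm_mul_lt h (not_le.mp hlt))

/-- `‖B‖ ≥ 1 / ‖μ‖` for a nonzero spectral point `μ`. [folklore] -/
theorem inv_norm_le_norm_of_memSpectrum {p : Submodule 𝕜 E} {L : p →ₗ[𝕜] E} {B : E →L[𝕜] E}
    (h : HasBoundedInverse p L B) {μ : 𝕜} (hμ : MemSpectrum p L μ) (hμ0 : μ ≠ 0) :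
    ‖μ‖⁻¹ ≤ ‖B‖ := by
  have hpos : 0 < ‖μ‖ := norm_pos_iff.mpr hμ0
  have := one_le_norm_mul_norm_of_memSpectrum h hμ
  rw [inv_le_iff_one_le_mul₀' hpos]
  linarith

/-- **`K₀ ≥ 4`**: over `ℂ`, if `1/4` is a spectral point of `L` then every bounded two-sided inverse
has norm at least `4`. (Use: LEMMA-D §7 of cell pub-nsjs, with `L = 𝓛_U` on `L²_σ` in the tree sign,
whose spectrum contains the closed half-plane `{Re λ ≥ 1/4}` — paper-level input, LEMMA-K0.md.) [folklore] -/
theorem four_le_norm_of_quarter_memSpectrum {E : Type*} [NormedAddCommGroup E] [NormedSpace ℂ E]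
    [CompleteSpace E] {p : Submodule ℂ E} {L : p →ₗ[ℂ] E} {B : E →L[ℂ] E}
    (h : HasBoundedInverse p L B) (hμ : MemSpectrum p L ((4 : ℂ)⁻¹)) : 4 ≤ ‖B‖ := by
  have := inv_norm_le_norm_of_memSpectrum h hμ (by norm_num)
  have h4 : ‖((4 : ℂ)⁻¹)‖ = 4⁻¹ := by
    rw [norm_inv]
    norm_num
  rw [h4, inv_inv] at this
  exact this

end Literature.Analysis.OperatorTheory
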